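import Summits.QuantumFields.YangMills.Theorems.BalabanUVNodesN08ReMassedACStepBounds

/-!
# BalabanUVNodes ∕ N08 — THE RE-MASSED AC TOWER, II: the remaining step leaves (C3–C14, B20) at the re-massed pieces and THEOREM 2 ((41) ∧ (47), every `k ≤ K`)
# for the re-massed tower `({ X.toTowerBase 𝔠.lane.carrier with W := W′ }.withSeriesAC 𝔖 _).tower3` from the (α)-AC rows

Track A, DAG node N08 = T. Bałaban, CMP **102** (1985) 255–275 [Balaban1985UV3]: Thm 2 p. 272, (41) p. 266, (47) p. 267, (55)–(63) pp. 269–272, (1) p. 256; the averaging (2) =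
[Balaban1985Averaging] (15) p. 19.  Cell `pub-ymgap`, width seat `pub-ymgap-dag-n08-w1` (g4), W-SEAT-START-LIST §n08 item 1 successor piece (o14) = file 20; `--supports` K1⁷
`StabilityBAtRecordR13SepCoPH` (helper).  Third of the «RE-MASSED AC TOWER» files (I-a `…N08SeriesACStepBounds`: normal forms + generic C1∕C2; I-b `…N08ReMassedACStepBounds`:
C1∕C2 for the re-massed base; this file: the mass-free leaves and Theorem 2; III: the analytic bundle, B25 pointwise for the capped masses, the slot).

WHAT THIS FILE PROVES (kernel; theorems only, 0 def; nothing of the paper asserted).  For a base `B′ = { X.toTowerBase 𝔠.lane.carrier with W := W′ }` (hypothesis `hB′`, `subst`):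
* §1 the MASS-FREE residual leaves at the re-massed pinned pieces `B′.seriesPiecesAC 𝔖 (piecesParamsOf …) k` from the (α)-AC step input `StepAlphaAC 𝔊 𝔠 X 𝔖 𝔄 k` on the
  `≤`-family: C3 `cumulant58_reMassed`, C4 `cumulantLower_reMassed`, C5 `repr33_60_reMassed`, C6 `vacuumWhole_reMassed`, C7 `decomp35_61_reMassed` (the (63) binder
  `𝔄.Λc k` re-typed at the re-massed tower field by field along I-a's normal forms: `logZLocalized_reMassed`), C8 `norm35_reMassed` and B20 `logZT_le_reMassed` (the GAP binders'
  CONCLUSIONS transported: `fun h ↦ h`), C10 `oldOutside_reMassed` — each the lane's GENERIC series provider (`LeavesCumAC`, `LeavesReprAC`, `LeavesOldAC`) at `B′`, constants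
  and run slots discharged exactly as in `Thm2AC.stepResidualsAC_of_alpha_le`; bookkeeping C9 `starCount_reMassed`, C13 `ztermSucc_reMassed`, C14 `rmSucc_reMassed`.
* §2 ★★ `exists_stepLeaves_reMassed` — THE FOURTEEN STEP LEAVES at the re-massed tower, step `k < K`, with the pieces PINNED (`Λ.P = B′.seriesPiecesAC …`), from `StepAlphaAC` +
  I-b's C1∕C2 (i.e. + `hae`∕`hle`∕`hWm`∕`hmt` on `W′`).
* §3 ★★★ `ineq41_47_reMassed` — **THEOREM 2 FOR THE RE-MASSED TOWER: (41) ∧ (47) for every `k ≤ K`** from `RunAlphaAC 𝔊 𝔠 X 𝔖 𝔄` + the four `W′`-hypotheses (LQB's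
  `thm2_of_leaves`, (1)₀ by `Step0Tower.step0_pin`, slot pinning `specOK_pin`) — Theorem 2 is as E6′-free for the re-massed masses as for print's (file 12 ∕ `Thm2AC`).

HONEST FRAMING: count-neutral helper; the (α)-AC rows and the `W′`-hypotheses are HYPOTHESES (N08's object gap in AC currency); N08 NOT discharged; one finite 𝕋⁴ programme at
fixed ε, Bałaban AS PRINTED — R4 closes the conditional finite-𝕋⁴ rung `BalabanLadder.UV` only; the Yang–Mills mass gap (Clay) is NOT proved by any of this; nothing continuum ∕
ℝ⁴ ∕ OS.  No `sorry`, standard axioms.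
-/

noncomputable section

open MeasureTheory Metric
open scoped BigOperators

namespace Summit.QuantumFields.YangMills.BalabanUVNodes.N08ReMassedACThm2

open Literature.MathematicalPhysics.QuantumFieldTheory.Balaban1983to89
open Literature.MathematicalPhysics.QuantumFieldTheory.Balaban1983to89.B10
open Literature.MathematicalPhysics.QuantumFieldTheory.Balaban1983to89.B10SectAGathering
open Literature.MathematicalPhysics.QuantumFieldTheory.Balaban1983to89.B10SectCExpansion (Bound44)
open Literature.MathematicalPhysics.QuantumFieldTheory.Balaban1983to89.B12TreeDecay (kappa₀ K₀)
open Literature.MathematicalPhysics.QuantumFieldTheory.Balaban1983to89.TreeLengthTorus (tsys TPt)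
open Literature.MathematicalPhysics.QuantumFieldTheory.Balaban1985CMP102
open Literature.MathematicalPhysics.QuantumFieldTheory.Balaban1985CMP102.Setting
open Literature.MathematicalPhysics.QuantumFieldTheory.Balaban1985CMP102.SectB (TowerObjects)
open Literature.MathematicalPhysics.QuantumFieldTheory.Balaban1985CMP102.Binders (LogZLocalizedAsCited)
open Summit.QuantumFields.Balaban3D
open Summit.QuantumFields.Balaban3D.Carriers
open Summit.QuantumFields.Balaban3D.Proofs
open Summit.QuantumFields.Balaban3D.Proofs.ScalesArithmetic
open Summit.QuantumFields.Balaban3D.Proofs.Inputs (nblk_cube_le_sites)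
open Summit.QuantumFields.Balaban3D.Proofs.TowerAC
open Summit.QuantumFields.Balaban3D.Proofs.SeriesAC
open Summit.QuantumFields.Balaban3D.Proofs.StandardAC
open Summit.QuantumFields.Balaban3D.Proofs.InputsAC
open Summit.QuantumFields.Balaban3D.Proofs.MassesAC (massRecAC)
open Summit.QuantumFields.Balaban3D.Proofs.AlphaAC (AlphaDataAC StepAlphaAC RunAlphaAC)
open Summit.QuantumFields.Balaban3D.Proofs.FamilyLE (thresholds_of_le)
open Summit.QuantumFields.Balaban3D.Proofs.UVStability3DInputs (adjAct hdet_adjAct)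
open Summit.QuantumFields.Balaban3D.Proofs.GroupModelLieC (lieC)
open Summit.QuantumFields.YangMills.BalabanUVNodes.N08SeriesACStepBounds
open Summit.QuantumFields.YangMills.BalabanUVNodes.N08ReMassedACStepBounds

variable {L : ℕ} {S : Scales L} {G : Type} [GaugeGroup G] [MeasurableSpace G] [HaarData G]
  {𝔊 : GroupModel G} {𝔠 : Primitives.AlphaConsts L 𝔊.N} {X : ExternalInputsAC S G}
  {𝔖 : ∀ k, StepSeries S G ↥(lieC 𝔊) (nblkOf S 𝔠.lane.carrier k) k} {𝔄 : AlphaDataAC 𝔊 𝔠 X 𝔖}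
  (hfam : S.g ^ 2 * S.ε₀ ≤ (min 𝔠.gamma0 1) ^ 2)
  (W' : HistWeightsAC S.P G) (B' : TowerBaseAC S G) (hB' : B' = { X.toTowerBase 𝔠.lane.carrier with W := W' })

/-! ## §1 The mass-free leaves at the re-massed pieces -/
section Leaves

include hfam hB' in
open Classical in
/-- **C3 at the re-massed pieces** (`LeavesCumAC.cumulant58_series_stdAC` at `B′`; inputs and discharges as `Thm2AC.stepResidualsAC_of_alpha_le`).
[cite: Balaban1985UV3, (24) p.262 + (58)–(59) p.270] -/
theorem cumulant58_reMassed {k : ℕ} (hk : k + 1 ≤ S.K) (A : StepAlphaAC 𝔊 𝔠 X 𝔖 𝔄 k) :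
    Cumulant58 (B'.seriesPiecesAC 𝔖 (piecesParamsOf S 𝔠.lane.carrier) k) 𝔠.lane.sc.Cz 𝔠.lane.sc.C₁ := by
  subst hB'
  haveI := A.hμ
  exact LeavesCumAC.cumulant58_series_stdAC _ 𝔖 (piecesParamsOf S 𝔠.lane.carrier) k 𝔠.kappa_ge 𝔠.C25_nonneg A.hact A.hboxm A.hbox A.hVm A.hVB
    A.h324a A.h324c 𝔠.Cac_nonneg (by omega) 𝔠.lane.F.κ₀_pos 𝔠.one_le_r₀ 𝔠.R₁_ge (norm_rem_eq S 𝔠.lane.F.κ₀ k).symm rfl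
    (nblk_cube_le_sites 𝔠.lane k (by omega)) A.hG (Thm2AC.bound25_actAC_of_le hfam k hk A)

include hfam hB' in
open Classical in
/-- **C4 at the re-massed pieces** (`LeavesCumAC.cumulantLower_series_stdAC` at `B′`). [cite: Balaban1985UV3, (37) p.265 + p.272 + (59) p.270] -/
theorem cumulantLower_reMassed {k : ℕ} (hk : k + 1 ≤ S.K) (A : StepAlphaAC 𝔊 𝔠 X 𝔖 𝔄 k) :
    CumulantLower (B'.seriesPiecesAC 𝔖 (piecesParamsOf S 𝔠.lane.carrier) k) 𝔠.lane.sc.C₁' := by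
  subst hB'
  haveI := A.hμ
  exact LeavesCumAC.cumulantLower_series_stdAC _ 𝔖 (piecesParamsOf S 𝔠.lane.carrier) k 𝔠.kappa_ge 𝔠.C25_nonneg A.hact A.hboxm A.hbox A.hVm
    A.hVB A.h324a A.h324c 𝔠.Cac_nonneg (by omega) 𝔠.lane.F.κ₀_pos 𝔠.one_le_r₀ 𝔠.R₁_ge (norm_rem_eq S 𝔠.lane.F.κ₀ k).symm rfl
    (nblk_cube_le_sites 𝔠.lane k (by omega)) A.hG (Thm2AC.bound25_actAC_of_le hfam k hk A)

include hfam hB' in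
/-- **C5 at the re-massed pieces** (`LeavesReprAC.repr33_60_seriesAC` at `B′`; (26) for the adjoint action, detecting). [cite: Balaban1985UV3, (33) p.264 + (60) p.271] -/
theorem repr33_60_reMassed {k : ℕ} (hk : k + 1 ≤ S.K) (A : StepAlphaAC 𝔊 𝔠 X 𝔖 𝔄 k) :
    Repr33_60 (B'.seriesPiecesAC 𝔖 (piecesParamsOf S 𝔠.lane.carrier) k) 𝔠.lane.sc.C₂ := by
  subst hB'
  exact LeavesReprAC.repr33_60_seriesAC _ 𝔖 (piecesParamsOf S 𝔠.lane.carrier) k (by omega) 𝔠.chart (by linarith [𝔠.kappa_ge]) 𝔠.C25_nonneg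
    𝔠.C25_le 𝔠.κ₀_lt_half 𝔠.lane.F.p₀_pos 𝔠.lane.F.b₀_nonneg (nblk_cube_le_sites 𝔠.lane k (by omega)) (Run3RepresentationStd.rem_std 𝔠.lane.carrier k)
    A.chart A.bound28 (thresholds_of_le hfam k (by omega)).2.2.2.2 (adjAct 𝔊 (P := S.P) k) A.inv26 (hdet_adjAct 𝔊 k) A.far_le A.hPY

include hB' in
/-- **C6 at the re-massed pieces** (`LeavesReprAC.vacuumWhole_seriesAC` at `B′`). [cite: Balaban1985UV3, p.265 + p.270 + (25) p.262] -/
theorem vacuumWhole_reMassed {k : ℕ} (hk : k + 1 ≤ S.K) (A : StepAlphaAC 𝔊 𝔠 X 𝔖 𝔄 k) :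
    VacuumWhole (B'.seriesPiecesAC 𝔖 (piecesParamsOf S 𝔠.lane.carrier) k) 𝔠.lane.sc.Cv 𝔠.lane.sc.C₃ := by
  subst hB'
  exact LeavesReprAC.vacuumWhole_seriesAC _ 𝔖 (piecesParamsOf S 𝔠.lane.carrier) k (by omega) 𝔠.kappa_ge 𝔠.C25_nonneg 𝔠.lane.F.κ₀_pos 𝔠.one_le_r₀
    𝔠.R₁_ge (nblk_cube_le_sites 𝔠.lane k (by omega)) (Run3RepresentationStd.rem_std 𝔠.lane.carrier k) rfl A.chart

include hfam hB' in
/-- **C7 at the re-massed pieces** (`LeavesReprAC.decomp35_61_seriesAC` at `B′`).  The (63) binder `𝔄.Λc k` (G3D-07 «as cited»: its pieces `Ψ`, far monomials and displays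
read no mass) is RE-TYPED at the re-massed tower field by field along I-a's normal forms (`seriesPiecesAC_logZU∕_logZ1`, `tower3_g∕_b₀∕_p₀`) — never tower-vs-tower — as a
`let`, so that the identification `hPYZ` still sees `Ψ`, `far` by `rfl`. [cite: Balaban1985UV3, (61) p.271 + (63) p.272 + (35) p.265] -/
theorem decomp35_61_reMassed {k : ℕ} (hk : k + 1 ≤ S.K) (A : StepAlphaAC 𝔊 𝔠 X 𝔖 𝔄 k) :
    Decomp35_61 (B'.seriesPiecesAC 𝔖 (piecesParamsOf S 𝔠.lane.carrier) k) 𝔠.lane.sc.C₄ := by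
  subst hB'
  let Λ' : LogZLocalizedAsCited (({ X.toTowerBase 𝔠.lane.carrier with W := W' } : TowerBaseAC S G).withSeriesAC 𝔖
        (piecesParamsOf S 𝔠.lane.carrier)).tower3.toTowerRun k (𝔖 k).E (adjAct 𝔊 (P := S.P) k) 𝔠.ρ 𝔠.r₀ 𝔠.Cfar 𝔠.C63 𝔠.κ
      ((({ X.toTowerBase 𝔠.lane.carrier with W := W' } : TowerBaseAC S G).seriesPiecesAC 𝔖 (piecesParamsOf S 𝔠.lane.carrier) k).logZU)
      ((({ X.toTowerBase 𝔠.lane.carrier with W := W' } : TowerBaseAC S G).seriesPiecesAC 𝔖 (piecesParamsOf S 𝔠.lane.carrier) k).logZ1)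
      (𝔖 k).Bcfg (fun h => Finset.univ.filter fun Y : (tsys 3 (nblkOf S 𝔠.lane.carrier k)).Dom =>
        Y.1 ⊆ ΩblkOf ({ X.toTowerBase 𝔠.lane.carrier with W := W' } : TowerBaseAC S G).M₁
          ({ X.toTowerBase 𝔠.lane.carrier with W := W' } : TowerBaseAC S G).Rcol (nblkOf S 𝔠.lane.carrier k) h) :=
    { Ψ := (𝔄.Λc k).Ψ
      expandDiff := fun h U => by
        have e := (𝔄.Λc k).expandDiff (@id (Hist S.P (k + 1)) h) (@id (GaugeField S.P (k + 1) G) U)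
        rw [seriesPiecesAC_logZU, seriesPiecesAC_logZ1]
        exact e
      chart := (𝔄.Λc k).chart
      inv26 := (𝔄.Λc k).inv26
      far := ((𝔄.Λc k).far : (tsys 3 (nblkOf S 𝔠.lane.carrier k)).Dom → Hist S.P (k + 1) → GaugeField S.P (k + 1) G → ℝ)
      far_le := by
        have h := (𝔄.Λc k).far_le
        simp only [tower3_g, tower3_b₀, tower3_p₀, withSeriesAC_b₀, withSeriesAC_p₀] at h ⊢
        dsimp only [inputOfAC, stdTowerInputAC, towerInputOfAC, ExternalInputsAC.toTowerBase] at h ⊢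
        simp only [withSeriesAC_b₀, withSeriesAC_p₀] at h
        exact h }
  have hr : 𝔠.chart.r₀ = 𝔠.lane.F.r₀ := rfl
  have h := LeavesReprAC.decomp35_61_seriesAC ({ X.toTowerBase 𝔠.lane.carrier with W := W' } : TowerBaseAC S G) 𝔖 (piecesParamsOf S 𝔠.lane.carrier) k
    (by omega) 𝔠.chart (κ := 𝔠.κ) (C63 := 𝔠.C63) (R₁ := 𝔠.lane.F.R₁)
    (by linarith [𝔠.kappa_ge]) 𝔠.C63_nonneg 𝔠.C63_le (hr ▸ 𝔠.one_le_r₀) 𝔠.lane.F.κ₀_pos 𝔠.κ₀_lt_half 𝔠.R₁_ge 𝔠.lane.F.p₀_pos 𝔠.lane.F.b₀_nonneg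
    (nblk_cube_le_sites 𝔠.lane k (by omega)) (Run3RepresentationStd.rem_std 𝔠.lane.carrier k) (by rw [hr]; rfl) A.bound28
    (thresholds_of_le hfam k (by omega)).2.2.2.2 (LogZLocalized.LogZLocalization.ofCited Λ' (hdet_adjAct 𝔊 k)) (fun h U => A.hPYZ h U)
  rw [hr] at h
  exact h

include hB' in
/-- **C8 at the re-massed pieces**: the GAP binder G3D-04's CONCLUSION `Norm35` at the std pieces (`AlphaAdaptersAC.norm35_piecesAC`) transported — it reads only the pieces'
series fields, which the two towers share (`fun h' ↦ h h'`). [cite: Balaban1985UV3, (35) p.265] -/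
theorem norm35_reMassed {k : ℕ} (A : StepAlphaAC 𝔊 𝔠 X 𝔖 𝔄 k) :
    Norm35 (B'.seriesPiecesAC 𝔖 (piecesParamsOf S 𝔠.lane.carrier) k) 𝔠.lane.sc.C₅ := by
  subst hB'
  have h := AlphaAdaptersAC.norm35_piecesAC 𝔠.lane X 𝔖 k 𝔠.c35_pos rfl A.norm35
  exact fun h' => h h'

include hB' in
/-- **B20 at the re-massed pieces**: `|log Z^{(k)}(T₁^{(k)}, 1)| ≤ z|T₁^{(k)}|` — the GAP binder G3D-05's CONCLUSION at the std pieces (`AlphaAdaptersAC.logZT_le_piecesAC`)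
transported (same `logZT`, same `|T₁^{(k)}|`). [cite: Balaban1985UV3, (65) p.273] -/
theorem logZT_le_reMassed {k : ℕ} (A : StepAlphaAC 𝔊 𝔠 X 𝔖 𝔄 k) :
    |(B'.seriesPiecesAC 𝔖 (piecesParamsOf S 𝔠.lane.carrier) k).logZT| ≤ 𝔠.lane.consts.z * S.sites k := by
  subst hB'
  exact AlphaAdaptersAC.logZT_le_piecesAC 𝔠.lane X 𝔖 k 𝔠.cT_pos rfl A.logZT

include hfam hB' in
/-- **C10 at the re-massed pieces** (`LeavesOldAC.oldOutside_series_gammaAC` at `B′`; rows `h44`, `hfloor`; threshold `γ_OO` from `g_k ≤ γ₀`).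
[cite: Balaban1985UV3, p.272 L29–31 + (44) p.267] -/
theorem oldOutside_reMassed {k : ℕ} (hk : k + 1 ≤ S.K) (A : StepAlphaAC 𝔊 𝔠 X 𝔖 𝔄 k) :
    OldOutside (B'.seriesPiecesAC 𝔖 (piecesParamsOf S 𝔠.lane.carrier) k) 𝔠.lane.sc.C₆ := by
  subst hB'
  have hC₆ : 𝔠.lane.sc.C₆ = 𝔠.C44 / 2 * (8 * (𝔠.lane.F.M₁ : ℝ) ^ 6)
      * (48 / (𝔠.κ₁ / 2) ^ 3 * Real.exp (𝔠.κ₁ / 2 / 2) / (1 - Real.exp (-(𝔠.κ₁ / 2 / 2)))) * (𝔠.lane.F.M₁ : ℝ)⁻¹ ^ 3 * ((L : ℝ) / ((L : ℝ) - 1)) := rfl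
  rw [hC₆]
  exact LeavesOldAC.oldOutside_series_gammaAC _ 𝔖 (piecesParamsOf S 𝔠.lane.carrier) k
    (by show k + 1 ≤ S.m + S.K; omega) 𝔠.C44_nonneg 𝔠.B₃_pos.le 𝔠.κ₁_pos 𝔠.lane.F.M₁_pos 𝔠.lane.F.b₀_pos 𝔠.lane.F.p₀_pos (gk_pos S k)
    (gk_le_one S S.gK_le_one k (by omega)) A.h44 A.hfloor (thresholds_of_le hfam k (by omega)).2.2.1

omit 𝔄 in
include hB' in
/-- **C9 at the re-massed pieces, `c₁ = 3`** (`StarCountRun3.starCount_leaf_run3`, every identification `rfl`). [cite: Balaban1985UV3, p.265 L8–9 + p.271 L13] -/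
theorem starCount_reMassed {k : ℕ} (hk : k + 1 ≤ S.K) : StarCount (B'.seriesPiecesAC 𝔖 (piecesParamsOf S 𝔠.lane.carrier) k) 3 := by
  subst hB'
  exact StarCountRun3.starCount_leaf_run3 (P := S.P) rfl 𝔠.lane.F.M₁ (rcolOf S 𝔠.lane.carrier) (by show k + 1 ≤ S.m + S.K; omega) rfl
    (({ X.toTowerBase 𝔠.lane.carrier with W := W' } : TowerBaseAC S G).seriesPiecesAC 𝔖 (piecesParamsOf S 𝔠.lane.carrier) k) rfl
    (fun _ => rfl) (fun _ => le_rfl)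

omit 𝔄 in
include hB' in
/-- **C13 at the re-massed pieces** (`Run3Zterm.ztermSucc_towerObjects`; the history projection keeps the recorded `|Z_j|`). [cite: Balaban1985UV3, (41) p.266 + p.271 L13] -/
theorem ztermSucc_reMassed (k : ℕ) :
    ZtermSucc (B'.seriesPiecesAC 𝔖 (piecesParamsOf S 𝔠.lane.carrier) k)
      ((𝔠.lane.sc.Cz + 𝔠.lane.sc.Cv) * (B'.withSeriesAC 𝔖 (piecesParamsOf S 𝔠.lane.carrier)).tower3.toTowerRun.g k + 𝔠.lane.sc.C₅ + 𝔠.lane.sc.C₆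
        + (|(B'.seriesPiecesAC 𝔖 (piecesParamsOf S 𝔠.lane.carrier) k).logσ₀| + (B'.seriesPiecesAC 𝔖 (piecesParamsOf S 𝔠.lane.carrier) k).dg
          * Real.log ((B'.withSeriesAC 𝔖 (piecesParamsOf S 𝔠.lane.carrier)).tower3.toTowerRun.g k)⁻¹) * 3) := by
  subst hB'
  let D : TowerInputAC S G := ({ X.toTowerBase 𝔠.lane.carrier with W := W' } : TowerBaseAC S G).withSeriesAC 𝔖 (piecesParamsOf S 𝔠.lane.carrier)
  refine ztermSucc_towerObjects D.tower3 _ (fun h j hj => ?_) (fun _ => rfl) le_rfl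
  show (D.towerWith fun _ => True).Zvol k (Hist.proj h) j = (D.towerWith fun _ => True).Zvol (k + 1) h j
  exact D.towerWith_Zvol_proj _ k h j hj

omit 𝔄 in
include hB' in
/-- **C14 at the re-massed pieces** (`VacuumAndBooking.rmSucc_of_sum_booking` with equality; `rcoefOf` books `rstar·g^{6+2κ₀}`). [cite: Balaban1985UV3, (41) p.266] -/
theorem rmSucc_reMassed (k : ℕ) :
    RmSucc (B'.seriesPiecesAC 𝔖 (piecesParamsOf S 𝔠.lane.carrier) k) (max 𝔠.lane.sc.C₁ 𝔠.lane.sc.C₁' + 𝔠.lane.sc.C₂ + 𝔠.lane.sc.C₃ + 𝔠.lane.sc.C₄) := by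
  subst hB'
  refine VacuumAndBooking.rmSucc_of_sum_booking _
    (fun j => rcoefOf S 𝔠.lane.carrier j * ((L : ℝ) ^ j * S.ε) ^ (3 + 𝔠.lane.carrier.κ₀) * S.sites j) _ (fun _ => rfl) (le_of_eq ?_)
  show 𝔠.lane.sc.rstar * ((S.gk k ^ 2) ^ (3 + 𝔠.lane.F.κ₀) * S.sites k)
    = rcoefOf S 𝔠.lane.carrier k * ((L : ℝ) ^ k * S.ε) ^ (3 + 𝔠.lane.F.κ₀) * S.sites k
  rw [Inputs.rcoefOf_carrier, gk_sq_rpow]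
  show 𝔠.lane.sc.rstar * ((S.g ^ 2) ^ (3 + 𝔠.lane.F.κ₀) * ((L : ℝ) ^ k * S.ε) ^ (3 + 𝔠.lane.F.κ₀) * S.sites k)
    = 𝔠.lane.sc.rstar * (S.g ^ 2) ^ (3 + 𝔠.lane.F.κ₀) * ((L : ℝ) ^ k * S.ε) ^ (3 + 𝔠.lane.F.κ₀) * S.sites k
  ring

end Leaves

/-! ## §2 The fourteen step leaves at the re-massed tower, pieces pinned -/
section Steps

variable (hae : ∀ j, j ≤ S.K → ∀ h : Hist S.P j, W'.mass j h =ᵐ[fieldMeasure S.P j G]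
    massRecAC 𝔠.lane.carrier.M₁ (rcolOf S 𝔠.lane.carrier) (eps1Of S 𝔠.lane.carrier) (epsSOf S 𝔠.lane.carrier) X.av j h)
  (hdom : ∀ (j : ℕ) (h : Hist S.P j) (U : GaugeField S.P j G),
    W'.mass j h U ≤ massRecAC 𝔠.lane.carrier.M₁ (rcolOf S 𝔠.lane.carrier) (eps1Of S 𝔠.lane.carrier) (epsSOf S 𝔠.lane.carrier) X.av j h U)
  (hWm : ∀ (j : ℕ) (h : Hist S.P j), Measurable (W'.mass j h)) (hmt : ∀ (j : ℕ) (U : GaugeField S.P j G), 1 ≤ W'.mass j (Hist.triv S.P j) U)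

include hfam hB' hae hdom hWm hmt in
/-- ★★ **THE FOURTEEN STEP LEAVES OF STEP `k → k+1` AT THE RE-MASSED TOWER, PIECES PINNED** (`Λ.P = B′.seriesPiecesAC …`): C1∕C2 from I-b, C3–C8∕C10 from §1, C9∕C11–C14 the
bookkeeping leaves, `c₁ := 3`; from `StepAlphaAC 𝔊 𝔠 X 𝔖 𝔄 k` on the `≤`-family and the four `W′`-hypotheses.  (As `Thm2AC.stepLeavesOfAC ∘ stepResidualsAC_of_alpha`, re-massed.)
[cite: Balaban1985UV3, (55)–(62) pp.269–271 + p.272] -/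
theorem exists_stepLeaves_reMassed {k : ℕ} (hk : k + 1 ≤ S.K) (A : StepAlphaAC 𝔊 𝔠 X 𝔖 𝔄 k) :
    ∃ Λ : StepLeaves (B'.withSeriesAC 𝔖 (piecesParamsOf S 𝔠.lane.carrier)).tower3.toTowerRun k, Λ.P = B'.seriesPiecesAC 𝔖 (piecesParamsOf S 𝔠.lane.carrier) k :=
  ⟨{ P := B'.seriesPiecesAC 𝔖 (piecesParamsOf S 𝔠.lane.carrier) k
     Cz := 𝔠.lane.sc.Cz, C₁ := 𝔠.lane.sc.C₁, C₁' := 𝔠.lane.sc.C₁', C₂ := 𝔠.lane.sc.C₂, Cv := 𝔠.lane.sc.Cv, C₃ := 𝔠.lane.sc.C₃,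
     C₄ := 𝔠.lane.sc.C₄, C₅ := 𝔠.lane.sc.C₅, c₁ := 3, C₆ := 𝔠.lane.sc.C₆
     bound55 := bound55_reMassed W' hae hdom B' hB' hWm hmt hk A
     bound55Lower := bound55Lower_reMassed W' B' hB' A
     cumulant58 := cumulant58_reMassed hfam W' B' hB' hk A
     cumulantLower := cumulantLower_reMassed hfam W' B' hB' hk A
     repr33_60 := repr33_60_reMassed hfam W' B' hB' hk A
     vacuumWhole := vacuumWhole_reMassed W' B' hB' hk A
     decomp35_61 := decomp35_61_reMassed hfam W' B' hB' hk A
     norm35 := norm35_reMassed W' B' hB' A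
     starCount := starCount_reMassed W' B' hB' hk
     oldOutside := oldOutside_reMassed hfam W' B' hB' hk A
     pintSucc := B'.pintSucc_seriesAC 𝔖 (piecesParamsOf S 𝔠.lane.carrier) k
     estep62 := B'.estep62_seriesAC 𝔖 (piecesParamsOf S 𝔠.lane.carrier) k
     ztermSucc := ztermSucc_reMassed W' B' hB' k
     rmSucc := rmSucc_reMassed W' B' hB' k }, rfl⟩

end Steps

/-! ## §3 Theorem 2 for the re-massed tower -/
section Thm2

variable (hae : ∀ j, j ≤ S.K → ∀ h : Hist S.P j, W'.mass j h =ᵐ[fieldMeasure S.P j G]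
    massRecAC 𝔠.lane.carrier.M₁ (rcolOf S 𝔠.lane.carrier) (eps1Of S 𝔠.lane.carrier) (epsSOf S 𝔠.lane.carrier) X.av j h)
  (hdom : ∀ (j : ℕ) (h : Hist S.P j) (U : GaugeField S.P j G),
    W'.mass j h U ≤ massRecAC 𝔠.lane.carrier.M₁ (rcolOf S 𝔠.lane.carrier) (eps1Of S 𝔠.lane.carrier) (epsSOf S 𝔠.lane.carrier) X.av j h U)
  (hWm : ∀ (j : ℕ) (h : Hist S.P j), Measurable (W'.mass j h)) (hmt : ∀ (j : ℕ) (U : GaugeField S.P j G), 1 ≤ W'.mass j (Hist.triv S.P j) U)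

omit 𝔄 in
include hB' in
/-- **(41)₀ ∧ (47)₀ FOR THE RE-MASSED TOWER** ((1) p. 256: one history with `LF 0 V F = exp (F triv)` (`TowerAC.lfAC_zero W′`), `U₀ = id`, `Pint 0 ≡ 0`) — `Step0Tower.step0_pin`.
[cite: Balaban1985UV3, (1) p.256] -/
theorem step0_reMassed : Step0Printed (B'.withSeriesAC 𝔖 (piecesParamsOf S 𝔠.lane.carrier)).tower3.toTowerRun := by
  subst hB'
  exact Step0Tower.step0_pin ((({ X.toTowerBase 𝔠.lane.carrier with W := W' } : TowerBaseAC S G).withSeriesAC 𝔖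
      (piecesParamsOf S 𝔠.lane.carrier)).towerWith fun _ => True) (fun V F => lfAC_zero W' V F)
    (fun V => by
      show (run3 ((({ X.toTowerBase 𝔠.lane.carrier with W := W' } : TowerBaseAC S G).withSeriesAC 𝔖
        (piecesParamsOf S 𝔠.lane.carrier)).toRunInput fun _ => True)).Uk 0 V = V
      rw [TowerInputAC.ukAll_eq]; rfl)
    (fun _ _ => rfl)

include hfam hB' hae hdom hWm hmt in
/-- ★★★ **BAŁABAN CMP 102 THEOREM 2 FOR THE RE-MASSED TOWER, MODULO THE (α)-AC ROWS**: on the `≤`-family `g²ε₀ ≤ (min γ₀ 1)²`, if `RunAlphaAC 𝔊 𝔠 X 𝔖 𝔄` holds and the mass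
carrier `W′` agrees `dU`-a.e. with print's `massRecAC` (levels `≤ K`), is dominated by it, measurable, and `≥ 1` at the trivial history, then the R-RN-selected densities of
`({ X.toTowerBase 𝔠.lane.carrier with W := W′ }.withSeriesAC 𝔖 _).tower3` satisfy (41) p. 266 and (47) p. 267 for every `k ≤ K` (LQB's `thm2_of_leaves`; (1)₀; slot pinning
`specOK_pin`; `0 < g_k ≤ 1`).  Theorem 2 is as E6′-free for the re-massed masses as for print's. [cite: Balaban1985UV3, Thm 2 p.272 + (41) p.266 + (47) p.267] -/
theorem ineq41_47_reMassed (R : RunAlphaAC 𝔊 𝔠 X 𝔖 𝔄) (k : ℕ) (hk : k ≤ S.K) :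
    Ineq41 (B'.withSeriesAC 𝔖 (piecesParamsOf S 𝔠.lane.carrier)).tower3.toTowerRun k ∧
      Ineq47 (B'.withSeriesAC 𝔖 (piecesParamsOf S 𝔠.lane.carrier)).tower3.toTowerRun k := by
  have h2 := thm2_of_leaves (I := Unit) (fun _ => (B'.withSeriesAC 𝔖 (piecesParamsOf S 𝔠.lane.carrier)).tower3.toTowerRun)
    (fun _ => TowerObjects.specOK_pin ((B'.withSeriesAC 𝔖 (piecesParamsOf S 𝔠.lane.carrier)).towerWith fun _ => True))
    (fun _ => step0_reMassed W' B' hB' (𝔖 := 𝔖))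
    (fun _ j hj => ⟨gk_pos S j, gk_le_one S S.gK_le_one j (by have hj' : j + 1 ≤ S.K := hj; omega)⟩)
    (fun _ j hj => (exists_stepLeaves_reMassed hfam W' B' hB' hae hdom hWm hmt hj (R.steps j hj)).choose)
  exact (TowerObjects.specOK_pin ((B'.withSeriesAC 𝔖 (piecesParamsOf S 𝔠.lane.carrier)).towerWith fun _ => True) k).mp (h2 () k hk)

end Thm2

end Summit.QuantumFields.YangMills.BalabanUVNodes.N08ReMassedACThm2

end
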